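import Summits.AnomalousDissipation.AnomalousDissipation.Statement
import Literature.Analysis.FluidPDE.DoeringFoiasProofs
import Literature.Analysis.FluidPDE.DoeringFoiasPowerProofs
import HarnessLib

/-!
# Necessary conditions on any witness of the zeroth law (solo-informed)

The summit `AnomalousDissipation` (= `Literature.Turb.ZerothLaw`) asks for ONE smooth,
divergence-free, mean-zero steady force `f` on `T³` and a vanishing-viscosity family of global
Leray–Hopf solutions `u_j` with bounded mean energy `⟨‖u_j‖₂²⟩ ≤ E` and mean dissipation
`⟨ν_j‖∇u_j‖₂²⟩ ≥ ε > 0`.  This file records, at kernel level, what every such witness must look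
like.  The inputs are two in-tree Literature theorems for Leray–Hopf solutions driven by a steady
`L²` mean-zero force (Cheskidov–Doering–Petrov 2007, eqs. (11), (17); Doering–Foias 2002, §2):
the power-balance inequality `⟨ν‖∇u‖₂²⟩ ≤ ⟨f·u⟩`
(`Literature.Analysis.FluidPDE.DoeringFoias2002_dissipation_le_power_holds`) and the power bound
`⟨f·u⟩ ≤ ‖f‖₂ ⟨‖u‖₂²⟩^{1/2}` (`Literature.Analysis.FluidPDE.Torus.IsGlobalLerayHopf.meanPower_le`).

Consequences for a witness `(f, ν_j, u_j, E, ε)`: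

* `zerothLaw_witness_injection_floor` — the velocity stays CORRELATED with the fixed force,
  `⟨f·u_j⟩ ≥ ε` for every `j` (so the zeroth law implies its "persistent injection" form,
  `anomalousDissipation_imp_persistentInjection`; the converse holds for bounded classical
  families, `anomalousDissipation_of_injectionFamily` in `SoloInformedInjectionBalance`);
* `zerothLaw_witness_energy_floor` — `f ≠ 0` in `L²` and the mean energy cannot degenerate:
  `⟨‖u_j‖₂²⟩ ≥ (ε/‖f‖₂)²` for every `j`, and `ε ≤ ‖f‖₂ √E`;
* `zerothLaw_witness_gradient_floor` / `…_gradient_tendsto_atTop` — the mean enstrophy obeys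
  `⟨‖∇u_j‖₂²⟩ ≥ ε/ν_j → ∞`: the family necessarily develops unbounded mean-square gradients at
  the dissipative rate `ν_j⁻¹` exactly (not faster: `⟨‖∇u_j‖₂²⟩ ≤ ‖f‖₂√E/ν_j`).

References: Cheskidov–Doering–Petrov, *Energy dissipation in body-forced turbulence*, J. Fluid
Mech. 2007, eqs. (11), (17) [CheskidovDoeringPetrov2006]; Doering–Foias, JFM 467 (2002) §2
[DoeringFoias2002].
-/

noncomputable section

open MeasureTheory Filter Topology Set
open scoped ENNReal NNReal InnerProductSpace RealInnerProductSpace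

namespace Summit.AnomalousDissipation.AnomalousDissipation.Theorems

open Literature.Analysis.FunctionSpaces Literature.Analysis.FluidPDE

/-- The physical flat unit torus `T³ = (ℝ/ℤ)³` (local notation). -/
local notation "𝕋³" => UnitAddTorus (Fin 3)
/-- Velocity values on `T³` (local notation). -/
local notation "E³" => EuclideanSpace ℝ (Fin 3)

/-! ### One Leray–Hopf solution -/

/-- **Power balance for one Leray–Hopf solution with a smooth steady mean-zero force**:
`⟨ν‖∇u‖₂²⟩ ≤ ⟨f·u⟩` (Cheskidov–Doering–Petrov 2007, eq. (11); in the tree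
`DoeringFoias2002_dissipation_le_power_holds`, smooth `f` being in `L²`).
[cite: CheskidovDoeringPetrov2006, eq. (11)] -/
theorem lerayHopf_meanDissipation_le_meanPower {ν : ℝ} (hν : 0 < ν) {f : 𝕋³ → E³}
    (hf : Torus.IsSmooth f) (hmean : Torus.HasZeroMean f) {u₀ : 𝕋³ → E³} {u : ℝ → 𝕋³ → E³}
    (hu : Torus.IsGlobalLerayHopf ν (fun _ => f) u₀ u) :
    meanDissipation ν u ≤ meanPower f u :=
  DoeringFoias2002_dissipation_le_power_holds hν (hf.memLp 2) hmean u₀ u hu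

/-- **Dissipation is controlled by force amplitude times r.m.s. velocity**:
`⟨ν‖∇u‖₂²⟩ ≤ ‖f‖₂ · ⟨‖u‖₂²⟩^{1/2}` for every global Leray–Hopf solution driven by a smooth steady
mean-zero force (Cheskidov–Doering–Petrov 2007, eqs. (11) and (17) with `α = 0`).
[cite: CheskidovDoeringPetrov2006, eq. (17)] -/
theorem lerayHopf_meanDissipation_le_norm_mul_sqrt_meanEnergy {ν : ℝ} (hν : 0 < ν) {f : 𝕋³ → E³}
    (hf : Torus.IsSmooth f) (hmean : Torus.HasZeroMean f) {u₀ : 𝕋³ → E³} {u : ℝ → 𝕋³ → E³}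
    (hu : Torus.IsGlobalLerayHopf ν (fun _ => f) u₀ u) :
    meanDissipation ν u ≤ Real.sqrt (∫ x, ‖f x‖ ^ 2) * Real.sqrt (meanEnergy u) := by
  have h := Torus.IsGlobalLerayHopf.meanPower_le hν hf hmean hu
  rw [rmsVelocity_eq_sqrt_meanEnergy] at h
  exact (lerayHopf_meanDissipation_le_meanPower hν hf hmean hu).trans h

/-- Elementary: if `0 < ε ≤ A · √y` with `0 ≤ A`, then `0 < A`, `0 ≤ y` and `(ε/A)² ≤ y`.
[folklore] -/
theorem sq_div_le_of_le_mul_sqrt {ε A y : ℝ} (hε : 0 < ε) (hA : 0 ≤ A)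
    (h : ε ≤ A * Real.sqrt y) : 0 < A ∧ 0 ≤ y ∧ (ε / A) ^ 2 ≤ y := by
  have hA' : 0 < A := by
    rcases hA.lt_or_eq with hA' | hA'
    · exact hA'
    · rw [← hA', zero_mul] at h
      exact absurd h (not_le.2 hε)
  have hy : 0 ≤ y := by
    by_contra hy
    rw [Real.sqrt_eq_zero'.2 (not_le.1 hy).le, mul_zero] at h
    exact absurd h (not_le.2 hε)
  refine ⟨hA', hy, ?_⟩
  have h1 : ε / A ≤ Real.sqrt y := by
    rw [div_le_iff₀ hA']
    linarith
  have h2 : 0 ≤ ε / A := div_nonneg hε.le hA'.le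
  calc (ε / A) ^ 2 ≤ Real.sqrt y ^ 2 := by gcongr
    _ = y := Real.sq_sqrt hy

/-- **Mean enstrophy floor**: `⟨ν‖∇u‖₂²⟩ ≥ ε` forces `⟨‖∇u‖₂²⟩ ≥ ε/ν` (the `limsup` mean commutes
with the nonnegative constant `ν`, `longTimeAvgSup_const_mul`). [folklore] -/
theorem gradient_mean_floor_of_dissipation_floor {ν ε : ℝ} (hν : 0 < ν) {u : ℝ → 𝕋³ → E³}
    (h : ε ≤ meanDissipation ν u) :
    ε / ν ≤ longTimeAvgSup (fun t => (Torus.eGradNormSq (u t)).toReal) := by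
  have e : meanDissipation ν u =
      ν * longTimeAvgSup (fun t => (Torus.eGradNormSq (u t)).toReal) := by
    unfold meanDissipation
    exact longTimeAvgSup_const_mul hν.le _
  rw [e] at h
  rw [div_le_iff₀ hν]
  linarith

/-- **Mean enstrophy ceiling**: conversely `⟨‖∇u‖₂²⟩ ≤ ‖f‖₂ ⟨‖u‖₂²⟩^{1/2} / ν` for every global
Leray–Hopf solution with a smooth steady mean-zero force (from
`lerayHopf_meanDissipation_le_norm_mul_sqrt_meanEnergy`). [cite: CheskidovDoeringPetrov2006, eq. (17)] -/
theorem lerayHopf_gradient_mean_le {ν : ℝ} (hν : 0 < ν) {f : 𝕋³ → E³}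
    (hf : Torus.IsSmooth f) (hmean : Torus.HasZeroMean f) {u₀ : 𝕋³ → E³} {u : ℝ → 𝕋³ → E³}
    (hu : Torus.IsGlobalLerayHopf ν (fun _ => f) u₀ u) :
    longTimeAvgSup (fun t => (Torus.eGradNormSq (u t)).toReal) ≤
      Real.sqrt (∫ x, ‖f x‖ ^ 2) * Real.sqrt (meanEnergy u) / ν := by
  have h := lerayHopf_meanDissipation_le_norm_mul_sqrt_meanEnergy hν hf hmean hu
  have e : meanDissipation ν u =
      ν * longTimeAvgSup (fun t => (Torus.eGradNormSq (u t)).toReal) := by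
    unfold meanDissipation
    exact longTimeAvgSup_const_mul hν.le _
  rw [e] at h
  rw [le_div_iff₀ hν]
  linarith

/-! ### Any witness of the zeroth law -/

/-- **Injection floor for witnesses.**  In any witness of the zeroth law the velocity stays
correlated with the fixed force: `⟨f·u_j⟩ ≥ ε` for every `j`.
[cite: CheskidovDoeringPetrov2006, eq. (11)] -/
theorem zerothLaw_witness_injection_floor {f : 𝕋³ → E³} (hf : Torus.IsSmooth f)
    (hmean : Torus.HasZeroMean f) {ν : ℕ → ℝ} {u₀ : ℕ → 𝕋³ → E³} {u : ℕ → ℝ → 𝕋³ → E³}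
    (hν : ∀ j, 0 < ν j) (hLH : ∀ j, Torus.IsGlobalLerayHopf (ν j) (fun _ => f) (u₀ j) (u j))
    {ε : ℝ} (hεle : ∀ j, ε ≤ meanDissipation (ν j) (u j)) (j : ℕ) :
    ε ≤ meanPower f (u j) :=
  (hεle j).trans (lerayHopf_meanDissipation_le_meanPower (hν j) hf hmean (hLH j))

/-- **Energy floor for witnesses.**  In any witness of the zeroth law the force is nonzero in
`L²` and the mean energies are bounded BELOW: `(ε/‖f‖₂)² ≤ ⟨‖u_j‖₂²⟩` for every `j`; moreover
`ε ≤ ‖f‖₂ √E` bounds the anomaly by the data. [cite: CheskidovDoeringPetrov2006, eq. (17)] -/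
theorem zerothLaw_witness_energy_floor {f : 𝕋³ → E³} (hf : Torus.IsSmooth f)
    (hmean : Torus.HasZeroMean f) {ν : ℕ → ℝ} {u₀ : ℕ → 𝕋³ → E³} {u : ℕ → ℝ → 𝕋³ → E³}
    (hν : ∀ j, 0 < ν j) (hLH : ∀ j, Torus.IsGlobalLerayHopf (ν j) (fun _ => f) (u₀ j) (u j))
    {E ε : ℝ} (hE : ∀ j, meanEnergy (u j) ≤ E) (hε : 0 < ε)
    (hεle : ∀ j, ε ≤ meanDissipation (ν j) (u j)) :
    0 < ∫ x, ‖f x‖ ^ 2 ∧ (∀ j, (ε / Real.sqrt (∫ x, ‖f x‖ ^ 2)) ^ 2 ≤ meanEnergy (u j)) ∧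
      ε ≤ Real.sqrt (∫ x, ‖f x‖ ^ 2) * Real.sqrt E := by
  set A : ℝ := Real.sqrt (∫ x, ‖f x‖ ^ 2) with hA
  have hA0 : 0 ≤ A := Real.sqrt_nonneg _
  have hj : ∀ j, ε ≤ A * Real.sqrt (meanEnergy (u j)) := fun j =>
    (hεle j).trans (lerayHopf_meanDissipation_le_norm_mul_sqrt_meanEnergy (hν j) hf hmean (hLH j))
  have h0 := sq_div_le_of_le_mul_sqrt hε hA0 (hj 0)
  refine ⟨?_, fun j => (sq_div_le_of_le_mul_sqrt hε hA0 (hj j)).2.2, ?_⟩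
  · have hApos : 0 < A := h0.1
    by_contra hneg
    have : A = 0 := by
      rw [hA]
      exact Real.sqrt_eq_zero'.2 (not_lt.1 hneg)
    exact absurd this hApos.ne'
  · exact (hj 0).trans (mul_le_mul_of_nonneg_left (Real.sqrt_le_sqrt (hE 0)) hA0)

/-- **Enstrophy floor for witnesses.**  In any witness of the zeroth law
`ε/ν_j ≤ ⟨‖∇u_j‖₂²⟩ ≤ ‖f‖₂√E/ν_j`: the mean-square gradients blow up at the dissipative rate
`ν_j⁻¹` exactly. [cite: CheskidovDoeringPetrov2006, eq. (17)] -/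
theorem zerothLaw_witness_gradient_floor {f : 𝕋³ → E³} (hf : Torus.IsSmooth f)
    (hmean : Torus.HasZeroMean f) {ν : ℕ → ℝ} {u₀ : ℕ → 𝕋³ → E³} {u : ℕ → ℝ → 𝕋³ → E³}
    (hν : ∀ j, 0 < ν j) (hLH : ∀ j, Torus.IsGlobalLerayHopf (ν j) (fun _ => f) (u₀ j) (u j))
    {E ε : ℝ} (hE : ∀ j, meanEnergy (u j) ≤ E)
    (hεle : ∀ j, ε ≤ meanDissipation (ν j) (u j)) (j : ℕ) :
    ε / ν j ≤ longTimeAvgSup (fun t => (Torus.eGradNormSq (u j t)).toReal) ∧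
      longTimeAvgSup (fun t => (Torus.eGradNormSq (u j t)).toReal) ≤
        Real.sqrt (∫ x, ‖f x‖ ^ 2) * Real.sqrt E / ν j := by
  refine ⟨gradient_mean_floor_of_dissipation_floor (hν j) (hεle j),
    (lerayHopf_gradient_mean_le (hν j) hf hmean (hLH j)).trans ?_⟩
  exact div_le_div_of_nonneg_right
    (mul_le_mul_of_nonneg_left (Real.sqrt_le_sqrt (hE j)) (Real.sqrt_nonneg _)) (hν j).le

/-- **Gradients must blow up.**  In any witness of the zeroth law the mean enstrophies tend to
infinity: `⟨‖∇u_j‖₂²⟩ → ∞` as `j → ∞` (from `ε/ν_j ≤ ⟨‖∇u_j‖₂²⟩`, `ν_j → 0⁺`). [folklore] -/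
theorem zerothLaw_witness_gradient_tendsto_atTop {ν : ℕ → ℝ} {u : ℕ → ℝ → 𝕋³ → E³}
    (hν : ∀ j, 0 < ν j) (hν0 : Tendsto ν atTop (𝓝 0)) {ε : ℝ} (hε : 0 < ε)
    (hεle : ∀ j, ε ≤ meanDissipation (ν j) (u j)) :
    Tendsto (fun j => longTimeAvgSup (fun t => (Torus.eGradNormSq (u j t)).toReal))
      atTop atTop := by
  have h1 : Tendsto ν atTop (𝓝[>] 0) :=
    tendsto_nhdsWithin_of_tendsto_nhds_of_eventually_within _ hν0
      (Eventually.of_forall fun j => hν j)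
  have h2 : Tendsto (fun j => (ν j)⁻¹) atTop atTop := tendsto_inv_nhdsGT_zero.comp h1
  have h3 : Tendsto (fun j => ε / ν j) atTop atTop := by
    simpa [div_eq_mul_inv] using h2.const_mul_atTop hε
  exact tendsto_atTop_mono (fun j => gradient_mean_floor_of_dissipation_floor (hν j) (hεle j)) h3

/-- **The zeroth law implies persistent injection.**  If `AnomalousDissipation` holds then there
are a smooth divergence-free mean-zero steady force `f`, viscosities `ν_j > 0`, `ν_j → 0`, and
global Leray–Hopf solutions `u_j` of `NS_{ν_j} + f` with bounded mean energy whose mean injected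
power stays bounded away from zero, `⟨f·u_j⟩ ≥ ε > 0` — the fixed force keeps drawing `O(1)` power
from bounded-energy flows as `ν → 0`.  (Converse for bounded classical families:
`anomalousDissipation_of_injectionFamily`.) [cite: CheskidovDoeringPetrov2006, eq. (11)] -/
theorem anomalousDissipation_imp_persistentInjection (h : _root_.AnomalousDissipation) :
    ∃ f : 𝕋³ → E³, Torus.IsSmooth f ∧ Torus.IsDivFree f ∧ Torus.HasZeroMean f ∧
      ∃ (ν : ℕ → ℝ) (u₀ : ℕ → 𝕋³ → E³) (u : ℕ → ℝ → 𝕋³ → E³),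
        (∀ j, 0 < ν j) ∧ Tendsto ν atTop (𝓝 0) ∧
        (∀ j, Torus.IsGlobalLerayHopf (ν j) (fun _ => f) (u₀ j) (u j)) ∧
        (∃ E : ℝ, ∀ j, meanEnergy (u j) ≤ E) ∧
        ∃ ε : ℝ, 0 < ε ∧ (∀ j, ε ≤ meanPower f (u j)) ∧
          (∀ j, (ε / Real.sqrt (∫ x, ‖f x‖ ^ 2)) ^ 2 ≤ meanEnergy (u j)) ∧
          ∀ j, ε / ν j ≤ longTimeAvgSup (fun t => (Torus.eGradNormSq (u j t)).toReal) := by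
  obtain ⟨f, hf, hdiv, hmean, ν, u₀, u, hν, hν0, hLH, ⟨E, hE⟩, ε, hε, hεle⟩ := h
  refine ⟨f, hf, hdiv, hmean, ν, u₀, u, hν, hν0, hLH, ⟨E, hE⟩, ε, hε,
    zerothLaw_witness_injection_floor hf hmean hν hLH hεle,
    (zerothLaw_witness_energy_floor hf hmean hν hLH hE hε hεle).2.1,
    fun j => (zerothLaw_witness_gradient_floor hf hmean hν hLH hE hεle j).1⟩

end Summit.AnomalousDissipation.AnomalousDissipation.Theorems

end
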